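import Literature.NumberTheory.EllipticCurves.LeadingTerm
import Literature.NumberTheory.EllipticCurves.Selmer
import HarnessLib

/-!
# Bhargava–Skinner–Zhang 2014, Theorem 5: trivial `p`-Selmer group ⇒ rank `0` and analytic rank `0`,
# at an odd prime `p` of good ordinary OR multiplicative reduction, under (irr) + (ram) — AS PRINTED
# (cited-only named fact) + the two one-leg specialisations

Topic `NumberTheory/EllipticCurves`, story `BhargavaSkinnerZhang2014/` (M. Bhargava, C. Skinner,
W. Zhang, *A majority of elliptic curves over `ℚ` satisfy the Birch and Swinnerton-Dyer conjecture*,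
arXiv:1407.1826 (2014); bib `BhargavaSkinnerZhang2014` = `arXiv14071826`). PRIMARY READ 2026-08-23
on the held text `paper:arxiv-1407.1826` (`lit read arxiv:1407.1826 --pages 5`; file `p0005.txt` is
arXiv p. 5, §2.1; every locator below is that page with the file:line of the held text beside it).

HONEST FRAMING (cell `b2b-bsdres`, run/shared/lean/b2b/bsd-rank1-residual/; BSD-DENSITY SPRINT,
coordinator directive relayed 2026-08-23T15:09Z; cell book `cells/density/CONVERSION-QUEUE.md` v0
§2 row Q1 "Q1-interim", §4 item 2, §5 LENDS; lend T-id **T-DENS-Q1I**, cc-lead GEN 83 WAKE +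
ADDENDA 1–2, lit GEN 111 lend word): the statement below is a SENTENCE typed VERBATIM AS PRINTED,
hypotheses complete; it is a `def … : Prop` consumed BY NAME as a hypothesis — it proves nothing,
books nothing and moves no density number, mark, label, count or tier. By-name consumer of record:
the glue seat D2 (`b2b-bsdres-dens-p1`), binder **`h5`** of the height-density theorem of record
`Literature.NumberTheory.EllipticCurves.bsz_rankLeOne_cRank_of_pieces`
(`LeadingTermBSZResCellAssemblyProofs.lean`: `∀ AB, IsInHeightFamily AB → S₀ AB → W AB →
Nat.card ((shortWeierstrass AB).selmerGroup 5) = 1 → (shortWeierstrass AB).mordellWeilRank = 0 ∧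
(shortWeierstrass AB).analyticRank = 0`, the rank-`0` criterion on the `5`-ORDINARY locus
`S₀(5)` = good ordinary ∪ multiplicative, under `W` = (irr) + (ram)), **instantiated at `p = 5`
ONLY**. Net debt `+1` (D-0026), consumer named; referee page-read asked at landing (sprint
mandate (ii)). Typed by cc-typer-3 GEN 16 (lent typer).

## The printed statement (verbatim; `p0005.txt` L7–L27)

§2.1, L7–L8: "We begin with the following criterion, deduced from results in [SU] and [Smult],
which gives a sufficient condition for an elliptic curve over `ℚ` to have algebraic and analytic
rank zero:"

**Theorem 5** (L10–L21). "Let `p` be an odd prime. Let `E` be an elliptic curve over `ℚ` with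
conductor `N` such that:
(a) `E` has good ordinary or multiplicative reduction at `p`;
(b) `E[p]` is an irreducible `Gal(ℚ̄/ℚ)`-module;
(c) there is at least one prime `ℓ ≠ p` such that `ℓ ∣∣ N` and `E[p]` is ramified at `ℓ`;
(d) the `p`-Selmer group `S_p(E)` of `E` is trivial.
Then the rank and analytic rank of `E` are both equal to `0`."

Proof as printed (L23–L27): "If the `p`-Selmer group `S_p(E)` of `E` is trivial, then so is the
`p^∞`-Selmer group (denoted `Sel_{p^∞}(E/ℚ)` and `Sel_{p^∞}(E)` in [SU] and [Smult],
respectively), and hence the Mordell–Weil group `E(ℚ)` is finite. It also follows from [SU] (for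
the case of good reduction at `p`) and [Smult] (for the case of multiplicative reduction at `p`)
that under the hypotheses on `E` stated in the theorem, we have `L(E,1) ≠ 0`. □"

**Remark 7** (L33–L38): "Suppose `ℓ ∣∣ N` and `ℓ ≠ p`. The condition that `E[p]` be ramified at
`ℓ` is equivalent to `p ∤ ord_ℓ(Δ_ℓ)` for a minimal discriminant `Δ_ℓ` of `E` at `ℓ`
[Silverman2]." **Remark 8** (L40–L47): "Both [SU] and [Smult], on which the proof of Theorem 5
relies, identify the power of `p` dividing the product of the order of the `p^∞`-Selmer group
`Sel_{p^∞}(E)` of `E` and the Tamagawa factors of `E` as the power of `p` dividing `L(E,1)/Ω_E`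
… this relation is a consequence of the Iwasawa–Greenberg main conjecture for `E` (which is the
main result of [SU] and [Smult]). One consequence of this equality of powers of `p` is that if
`Sel_{p^∞}(E)` is finite, then `L(E,1) ≠ 0`."
Here [SU] = C. Skinner, E. Urban, Invent. Math. 195 (2014) (Thm. 2 = Thm. 3.6.11) and [Smult] =
C. Skinner, Pacific J. Math. 283 (2016) (Thms. A–C).

## What is vendored, and in which currency (the verbatim ↔ Lean dictionary, one line per clause)

ONE cited-only named fact, `BhargavaSkinnerZhang2014.thm5_rank_zero_of_pSelmer_trivial` =
Theorem 5. MODEL CURRENCY: the binders are those of the tree's transcription of [Smult] Thm. C,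
`Literature.NumberTheory.EllipticCurves.Skinner2016.thmC_padicValRat_bsd_rank_zero`
(`Skinner2016/RankZeroPPart.lean`, registry row A2) BYTE FOR BYTE — `W` a GLOBALLY MINIMAL model of
`E/ℚ` (`[W.IsGloballyMinimal]`: `W.frobeniusTrace p` and `W.minimalDiscriminantInt` are declared
over minimal models), so that one curve's hypothesis witnesses serve A1 / A2 / A16 / A31 and this
fact alike; the transport `shortWeierstrass AB ↝` minimal model needed by `h5` is the consumer's
glue (CONVERSION-QUEUE q5), not part of this file.
* "`p` an odd prime" = `(p : ℕ) [Fact p.Prime] (_hp : 3 ≤ p)`.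
* (a) "good ordinary or multiplicative reduction at `p`" = `_hred :
  (W.HasGoodReductionAtPrime p ∧ ¬ (p : ℤ) ∣ W.frobeniusTrace p) ∨
  W.HasMultiplicativeReductionAtPrime p` (A2's `_hred` verbatim; ordinary = `p ∤ a_p`).
* (b) "`E[p]` is an irreducible `Gal(ℚ̄/ℚ)`-module" = `_hirr : W.HasIrreducibleModPGaloisRep p`.
* (c) "at least one prime `ℓ ≠ p` such that `ℓ ∣∣ N` and `E[p]` is ramified at `ℓ`" = `_hram :
  ∃ ℓ, ∃ _ : Fact ℓ.Prime, ℓ ≠ p ∧ W.HasMultiplicativeReductionAtPrime ℓ ∧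
  ¬ p ∣ padicValInt ℓ W.minimalDiscriminantInt` — `ℓ ∣∣ N` ⟺ multiplicative reduction at `ℓ`, and
  for such `ℓ ≠ p`, "`E[p]` ramified at `ℓ`" ⟺ `p ∤ ord_ℓ(Δ_min)` (the paper's own Remark 7, Tate
  curve); this is A2's `_hram` and Skinner–Urban's `haux` verbatim (= `Rank1Residual.Ram`).
* (d) "the `p`-Selmer group `S_p(E)` of `E` is trivial" = `_hSel : Nat.card (W.selmerGroup p) = 1`
  (`WeierstrassCurve.selmerGroup W (p : ℤ) ⊆ H¹(ℚ, E[p])`, file `Selmer`; the tree's standing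
  reading of "trivial `p`-Selmer group", cf. the binder `h5` itself and
  `mordellWeilRank_eq_zero_and_torsionBy_eq_bot_of_natCard_selmerGroup_eq_one`).
* "the rank and analytic rank of `E` are both equal to `0`" = `W.mordellWeilRank = 0 ∧
  W.analyticRank = 0` (`rank_ℤ E(ℚ)`, `ord_{s=1} L(E,s)`).
Nothing printed is dropped or added.

## Status paragraph (registry wording; the tier word is referee A's, the row is lit's pen)

Source = arXiv PREPRINT (BSZ 2014, no journal version) printing a DEDUCTION from [SU] =
Skinner–Urban 2014 Thm. 2 / 3.6.11 (PUB) and [Smult] = Skinner, Pacific J. Math. 283 (2016)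
Thms. A–C (PUB) ⇒ proposed label «literal-sec» (CONVERSION-QUEUE §5; pub-bsdpct `AUDIT.md` §B row
B1.2 "[sec: BSZ Thm 5]"); the tier word is referee A's.

## The `p = 3` reading (registry wording, verbatim; A1 / A2 / A3 / A16 carry it; referee A R152.2,
## lit GEN 62 block S-g62-1)

Thm 5 prints "p odd", so p = 3 is INSIDE the print; its inputs at p = 3 are Skinner–Urban 2014
Thm 3.6.9 / 3.6.11 (A16 / A1) and Skinner 2016 Thms A / C (A31 / A2), whose registry status is
**PUB (p ≥ 5; flag `SU14-12.3.6-mu@nonsplit` informational, R146.6; printed repair Wan 2015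
Lemma 87 / Thm 101 / Thm 103, each "p ≥ 5") · PUB\* AT p = 3 — flag `SU14-12.3.6-mu@nonsplit@3`
ACTIVE-PRINT-GAP (R152.2: gap active at every p = 3 instance — the (ram) prime q is inert in K
with q ∈ Σ, the w ∣ q factor of (12.3.5.b) is (q² − 1)/q², 3 ∣ q² − 1 for every q ≠ 3; refereed
repair at p = 3: NONE located (no S–U erratum in Crossref; BCS IMRN 2025 "p > 3"; Wan Thm 86's proof
excludes p = 3); a non-[SU] road at `3` is announced only for `N` square-free — BSTW
arXiv:2409.01350v2 Thm. 10.10 (a) (zeta elements; Rem. 10.11), PRE, typed as the OPEN binder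
`BurungaleSkinnerTianWan2024.thm1010a_mainStatement_semistable_ordinary_OPEN` (whose STATEMENT
already follows from `skinner_urban_main_conjecture`:
`…thm1010a_mainStatement_semistable_ordinary_OPEN_of_skinnerUrban`); BSTW's own Thm. 9.21 (c) / Thm.
12.3 at `p = 3` run through [SU] Thm. 3.29 under (ram))**. Hence this fact is usable AS PRINTED at p
≥ 5 («literal-sec» pending referee A); at p = 3 it INHERITS PUB\* /
ACTIVE-PRINT-GAP and is not to be instantiated at 3 by any class theorem without the flag
travelling; the density-sprint consumer instantiates p = 5 only.

## Dedup (OWNERS §0 item 7; `lean search` + `grep CITED-FACTS.md`, 2026-08-23, this seat)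

* [SU] Thm. 2 (b) = Thm. 3.6.11 (b) is NOT re-minted as a `def`: it is in the tree as KERNEL
  THEOREMS (namespace `Literature.NumberTheory.EllipticCurves.SkinnerUrban2014`)
  `thm3611b_one_le_selmerCorank_of_entireLFunction_one_eq_zero` and its corank form
  `analyticRank_eq_zero_of_selmerCorank_eq_zero_of_mainConjecture`
  (`SkinnerUrban2014/SelmerCorankOfVanishingLValueProofs.lean`, p238343; `3 ≤ p`, good ordinary,
  `hirr`, `haux` = (ram); proved below the named fact A16 `skinner_urban_main_conjecture` +
  `exists_isNewformOf`), and — (ram)-free at `p ≥ 5` — the namesake theorem of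
  `BSDSelmerPConverseRankZeroProofs.lean` (Burungale–Castella–Skinner 2025 Thm. 1.1.2 route). So
  the GOOD-ORDINARY leg of Theorem 5 is already kernel-side below A16 (Summits-side display:
  `Summit.BirchSwinnertonDyer.Rank1Residual.X10.RankZeroOfTrivialPSelmer`, x10 GEN 28).
* [Smult] Thm. C clause (1) (`L(E,1) ≠ 0` ⇒ the `p`-part formula) = A2
  `Skinner2016.thmC_padicValRat_bsd_rank_zero` / A3 (DUP pair, bridge
  `Skinner2016_thmC_iff_padicValRat_bsd_rank_zero`): not again. Clause (2) ("if `L(E,1) = 0` then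
  `Sel_{p^∞}(E)` has `ℤ_p`-corank at least one") — the MULTIPLICATIVE-at-`p` input of Theorem 5 — is
  the separate as-printed fact `Skinner2016.thmC_one_le_selmerCorank_of_L_one_eq_zero`
  (`Skinner2016/SelmerCorankOfVanishingLValue.lean`, same T-id, FILE 2).
* `BhargavaSkinnerZhang2014.CellTheorem.RankZeroConverseOn inv p C G` (same cite
  `[BhargavaSkinnerZhang2014, Thm 5]`) is the ABSTRACT per-cell CONSUMER shape over the bookkeeping
  record `Invariants` (`selmerRank` / `analyticRank` as abstract fields on the height family) that
  this fact is meant to instantiate through D2's glue — not the printed theorem over elliptic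
  curves, and this file is not a restatement of it. Verbatim concrete-currency statement of [BSZ]
  Thm 5 over `WeierstrassCurve ℚ` with the printed hypotheses (a)–(d) explicit: none in the tree
  (`lean search 'thm5_' / '1407.1826' / 'BhargavaSkinnerZhang2014, Thm 5'`; CITED-FACTS §A: no row).

Nothing is asserted; no `_holds` is expected from this file (the Iwasawa–Greenberg main
conjectures of [SU] / [Smult] are named facts of the tree, not theorems). Proved here: only the two
one-leg SPECIALISATIONS of the fact (`thm5_of_goodOrdinary`, `thm5_of_multiplicative` — the
disjunction (a) instantiated with `Or.inl` / `Or.inr`, for the consumer's two legs of `S₀(5)`).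

## References

* M. Bhargava, C. Skinner, W. Zhang, arXiv:1407.1826 (2014), §2.1: Theorem 5 (p. 5), Remarks 6–8
  (p. 5). [BhargavaSkinnerZhang2014]
* C. Skinner, E. Urban, Invent. Math. 195 (2014) 1–277, Thm. 2 = Thm. 3.6.11 (p. 46), Thm. 3.6.9
  (p. 45). [SkinnerUrban2014]
* C. Skinner, Pacific J. Math. 283 (2016) 171–200, Thms. A–C (§1), footnote 1, §2.5.
  [Skinner2016PacificMC]
-/

noncomputable section

open scoped Classical

open WeierstrassCurve

namespace Literature.NumberTheory.EllipticCurves.BhargavaSkinnerZhang2014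

/-- **Bhargava–Skinner–Zhang 2014, Theorem 5** (arXiv:1407.1826, §2.1, p. 5; held text
`paper:arxiv-1407.1826` p0005 L10–L21), verbatim: "Let `p` be an odd prime. Let `E` be an elliptic
curve over `ℚ` with conductor `N` such that: (a) `E` has good ordinary or multiplicative reduction
at `p`; (b) `E[p]` is an irreducible `Gal(ℚ̄/ℚ)`-module; (c) there is at least one prime `ℓ ≠ p`
such that `ℓ ∣∣ N` and `E[p]` is ramified at `ℓ`; (d) the `p`-Selmer group `S_p(E)` of `E` is
trivial. Then the rank and analytic rank of `E` are both equal to `0`." — "deduced from results in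
[SU] and [Smult]" (ibid. L7; proof L23–L27: [SU] = Skinner–Urban 2014 for good reduction at `p`,
[Smult] = Skinner 2016 for multiplicative reduction at `p`).
Transcription (binders BYTE-FOR-BYTE those of A2 `Skinner2016.thmC_padicValRat_bsd_rank_zero`;
`W` a globally minimal model of `E/ℚ`): "odd prime" = `3 ≤ p`; (a) = `_hred` (good with
`p ∤ a_p(E)`, or multiplicative); (b) = `_hirr`; (c) = `_hram` — `ℓ ∣∣ N` ⟺ multiplicative
reduction at `ℓ`, and for such `ℓ ≠ p` "`E[p]` ramified at `ℓ`" ⟺ `p ∤ ord_ℓ(Δ_min)` (Remark 7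
of the source; Tate curve); (d) = `_hSel : Nat.card (W.selmerGroup p) = 1` (`Sel^(p)(E/ℚ) ⊆
H¹(ℚ, E[p])` trivial); conclusion `W.mordellWeilRank = 0 ∧ W.analyticRank = 0`.
STATUS: source = arXiv preprint printing a deduction from [SU] Thm. 2 / 3.6.11 (PUB) and [Smult]
Thms. A–C (PUB) ⇒ proposed label «literal-sec» (the tier word is referee A's). THE `p = 3`
READING (registry wording): Thm 5 prints "p odd", so `p = 3` is inside the print; its inputs at
`p = 3` (A16 / A1, A31 / A2) are PUB at `p ≥ 5` and PUB\* at `p = 3` — flag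
`SU14-12.3.6-mu@nonsplit@3` ACTIVE-PRINT-GAP (referee A R152.2; no refereed repair at `p = 3`
located; a non-[SU] road at `3` is announced only for `N` square-free — BSTW arXiv:2409.01350v2 Thm.
10.10 (a) (zeta elements; Rem. 10.11), PRE, typed as the OPEN binder
`BurungaleSkinnerTianWan2024.thm1010a_mainStatement_semistable_ordinary_OPEN` (whose STATEMENT
already follows from `skinner_urban_main_conjecture`:
`…thm1010a_mainStatement_semistable_ordinary_OPEN_of_skinnerUrban`); BSTW's own Thm. 9.21 (c) / Thm.
12.3 at `p = 3` run through [SU] Thm. 3.29 under (ram)); hence usable AS PRINTED at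
`p ≥ 5`, and at `p = 3` it INHERITS PUB\* / ACTIVE-PRINT-GAP and is not to be instantiated at `3`
by any class theorem without the flag travelling. By-name consumer: D2 `b2b-bsdres-dens-p1`,
binder `h5` of `bsz_rankLeOne_cRank_of_pieces`, instantiated at `p = 5` ONLY (model transport
`shortWeierstrass AB ↝` minimal model is D2's glue). Dedup: [SU] Thm. 2 (b) is the kernel theorem
`SkinnerUrban2014.thm3611b_one_le_selmerCorank_of_entireLFunction_one_eq_zero` (no `def`);
[Smult] Thm. C (1) = A2 / A3; `CellTheorem.RankZeroConverseOn` (same cite) is the abstract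
per-cell consumer shape over `Invariants`, not this concrete statement. Nothing is asserted; no
`_holds` expected.
[cite: BhargavaSkinnerZhang2014, Thm. 5 (§2.1, arXiv p. 5; held text p0005 L10–L21), Rem. 7] -/
def thm5_rank_zero_of_pSelmer_trivial : Prop :=
  ∀ (W : WeierstrassCurve ℚ) [W.IsElliptic] [W.IsGloballyMinimal] (p : ℕ) [Fact p.Prime]
    (_hp : 3 ≤ p)
    (_hred : (W.HasGoodReductionAtPrime p ∧ ¬ (p : ℤ) ∣ W.frobeniusTrace p) ∨
      W.HasMultiplicativeReductionAtPrime p)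
    (_hirr : W.HasIrreducibleModPGaloisRep p)
    (_hram : ∃ ℓ : ℕ, ∃ _ : Fact ℓ.Prime, ℓ ≠ p ∧ W.HasMultiplicativeReductionAtPrime ℓ ∧
      ¬ p ∣ padicValInt ℓ W.minimalDiscriminantInt)
    (_hSel : Nat.card (W.selmerGroup p) = 1),
    W.mordellWeilRank = 0 ∧ W.analyticRank = 0

/-- Theorem 5 on its GOOD ORDINARY leg (hypothesis (a) instantiated with `Or.inl`): at an odd
prime `p` of good reduction with `p ∤ a_p(E)`, under (irr) + (ram), a trivial `p`-Selmer group
forces rank `0` and analytic rank `0`. (This leg is [SU] Thm. 2 (b) + descent; kernel-side below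
A16 as `SkinnerUrban2014.analyticRank_eq_zero_of_selmerCorank_eq_zero_of_mainConjecture`.)
[cite: BhargavaSkinnerZhang2014, Thm. 5 (§2.1, arXiv p. 5), hypothesis (a), first alternative] -/
theorem thm5_of_goodOrdinary (h : thm5_rank_zero_of_pSelmer_trivial)
    (W : WeierstrassCurve ℚ) [W.IsElliptic] [W.IsGloballyMinimal] (p : ℕ) [Fact p.Prime]
    (hp : 3 ≤ p) (hgood : W.HasGoodReductionAtPrime p) (hord : ¬ (p : ℤ) ∣ W.frobeniusTrace p)
    (hirr : W.HasIrreducibleModPGaloisRep p)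
    (hram : ∃ ℓ : ℕ, ∃ _ : Fact ℓ.Prime, ℓ ≠ p ∧ W.HasMultiplicativeReductionAtPrime ℓ ∧
      ¬ p ∣ padicValInt ℓ W.minimalDiscriminantInt)
    (hSel : Nat.card (W.selmerGroup p) = 1) :
    W.mordellWeilRank = 0 ∧ W.analyticRank = 0 :=
  h W p hp (Or.inl ⟨hgood, hord⟩) hirr hram hSel

/-- Theorem 5 on its MULTIPLICATIVE leg (hypothesis (a) instantiated with `Or.inr`): at an odd
prime `p` of multiplicative reduction, under (irr) + (ram), a trivial `p`-Selmer group forces rank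
`0` and analytic rank `0`. (This leg is [Smult] Thm. C clause (2) + descent — the as-printed fact
`Skinner2016.thmC_one_le_selmerCorank_of_L_one_eq_zero` of the sibling file; it is the leg the
density consumer `h5` needs on the multiplicative part of `S₀(5)`.)
[cite: BhargavaSkinnerZhang2014, Thm. 5 (§2.1, arXiv p. 5), hypothesis (a), second alternative] -/
theorem thm5_of_multiplicative (h : thm5_rank_zero_of_pSelmer_trivial)
    (W : WeierstrassCurve ℚ) [W.IsElliptic] [W.IsGloballyMinimal] (p : ℕ) [Fact p.Prime]
    (hp : 3 ≤ p) (hmult : W.HasMultiplicativeReductionAtPrime p)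
    (hirr : W.HasIrreducibleModPGaloisRep p)
    (hram : ∃ ℓ : ℕ, ∃ _ : Fact ℓ.Prime, ℓ ≠ p ∧ W.HasMultiplicativeReductionAtPrime ℓ ∧
      ¬ p ∣ padicValInt ℓ W.minimalDiscriminantInt)
    (hSel : Nat.card (W.selmerGroup p) = 1) :
    W.mordellWeilRank = 0 ∧ W.analyticRank = 0 :=
  h W p hp (Or.inr hmult) hirr hram hSel

end Literature.NumberTheory.EllipticCurves.BhargavaSkinnerZhang2014

end
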